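import Summits.KontsevichZagierPeriods.KontsevichZagierPeriods.Theorems.K2SymbolChainsJensenIsScissorsRadialCore2
import Summits.KontsevichZagierPeriods.KontsevichZagierPeriods.Theorems.K2SymbolChainsJensenIsScissorsProduct
import Summits.KontsevichZagierPeriods.KontsevichZagierPeriods.Theorems.K2SymbolChainsJensenIsScissorsDoublingAux

/-!
# Jensen is scissors — the radial step `[J(ρ)] ~ [J(ρ²)]` for `0 < ρ < 1`

Support file for item stmt-KontsevichZagierPeriods-5204 (`JensenIsScissors`, route
KontsevichZagierPeriods/K2SymbolChains). For a centre function `0 < ρ < 1`, `ℚ`-semialgebraic and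
differentiable at the points of `B`, and a `ℚ`-semialgebraic weight `h` with `h` and `h log ρ`
integrable on `B`, the signed unfoldings `L(ρ)`, `L(ρ²)` of `h(x)/(1 + s²) · log W_{ρ(x)}(s)`,
`h(x)/(1 + s²) · log W_{ρ(x)²}(s)` over `B × ℝ` (`W_r(s) = ((1 − r)² + (1 + r)² s²)/(1 + s²)`) satisfy
`[L(ρ)] − [L(ρ²)] ∈ S` for any subgroup `S` containing the three scissors move sets ("radial
constancy of Jensen's integral inside the disc, as a finite chain"). With `M = (1 + ρ)²`, over the
co-null base `{s ≠ 0}`: `[L(M W_ρ)] ~ [L(M)] + [L(ρ)]` (signed product rule, file `Product`),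
`[L(M W_ρ)] − [L(ρ²)] ~ [band(W_{ρ²}, M W_ρ)]` (signed Chasles relation, file `Band`), and
`[band] ~ [L(M)]` (files `RadialCore1/2`). [Kontsevich–Zagier 2001, §1.2, rules 1)–2)] [folklore]
-/

noncomputable section

open MeasureTheory Set
open Literature.NumberTheory.Transcendental Literature.ModelTheory.ExponentialFields

namespace Summit.KontsevichZagierPeriods.K2SymbolChains.JensenIsScissorsProof

open Literature.NumberTheory.Transcendental.KZ

variable {n : ℕ} {S : AddSubgroup FormalRep}

/-- **The radial step.** See the module docstring. [Kontsevich–Zagier 2001, §1.2] [folklore] -/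
theorem radial_step (hS : domainAddRel ∪ integrandAddRel ∪ changeOfVariablesRel ⊆ S)
    {B : Set (Fin n → ℝ)} {h ρ : (Fin n → ℝ) → ℝ}
    (hB : IsSemialgebraic ℚ B) (hh : IsSemialgebraicFunOn ℚ B h) (hρs : IsSemialgebraicFunOn ℚ B ρ)
    (hρ0 : ∀ x ∈ B, 0 < ρ x) (hρ1 : ∀ x ∈ B, ρ x < 1) (hρd : ∀ x ∈ B, DifferentiableAt ℝ ρ x)
    (hhi : IntegrableOn h B) (hhlog : IntegrableOn (fun x => h x * Real.log (ρ x)) B)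
    (R R₂ : IntegralRep (n + 1 + 1))
    (hRd : R.domain = logUnfoldDomain {b : Fin (n + 1) → ℝ | Fin.init b ∈ B}
      (fun b => ((1 - ρ (Fin.init b)) ^ 2 + (1 + ρ (Fin.init b)) ^ 2 * b (Fin.last n) ^ 2) /
        (1 + b (Fin.last n) ^ 2)))
    (hRi : EqOn R.integrand (logUnfoldIntegrand fun b => h (Fin.init b) / (1 + b (Fin.last n) ^ 2)) R.domain)
    (hR₂d : R₂.domain = logUnfoldDomain {b : Fin (n + 1) → ℝ | Fin.init b ∈ B}
      (fun b => ((1 - ρ (Fin.init b) ^ 2) ^ 2 + (1 + ρ (Fin.init b) ^ 2) ^ 2 * b (Fin.last n) ^ 2) /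
        (1 + b (Fin.last n) ^ 2)))
    (hR₂i : EqOn R₂.integrand (logUnfoldIntegrand fun b => h (Fin.init b) / (1 + b (Fin.last n) ^ 2)) R₂.domain) :
    of R - of R₂ ∈ S := by
  -- notation
  set T : Set (Fin (n + 1) → ℝ) := {b | Fin.init b ∈ B} with hT_def
  set T' : Set (Fin (n + 1) → ℝ) := {b | Fin.init b ∈ B ∧ b (Fin.last n) ≠ 0} with hT'_def
  set G : (Fin (n + 1) → ℝ) → ℝ := fun b => h (Fin.init b) / (1 + b (Fin.last n) ^ 2) with hG_def
  set W : (Fin (n + 1) → ℝ) → ℝ := fun b =>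
    ((1 - ρ (Fin.init b)) ^ 2 + (1 + ρ (Fin.init b)) ^ 2 * b (Fin.last n) ^ 2) / (1 + b (Fin.last n) ^ 2)
    with hW_def
  set W₂ : (Fin (n + 1) → ℝ) → ℝ := fun b =>
    ((1 - ρ (Fin.init b) ^ 2) ^ 2 + (1 + ρ (Fin.init b) ^ 2) ^ 2 * b (Fin.last n) ^ 2) /
      (1 + b (Fin.last n) ^ 2) with hW₂_def
  set M : (Fin (n + 1) → ℝ) → ℝ := fun b => (1 + ρ (Fin.init b)) ^ 2 with hM_def
  -- semialgebraicity, positivity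
  have hT : IsSemialgebraic ℚ T := isSemialgebraic_cyl hB
  have hsT := isSemialgebraicFunOn_apply hT (Fin.last n)
  have hT's : IsSemialgebraic ℚ T' := hsT.isSemialgebraic_sep_ne_zero
  have hT'T : T' ⊆ T := fun b hb => hb.1
  have hT'B : T' ⊆ {b : Fin (n + 1) → ℝ | Fin.init b ∈ B} := hT'T
  have hGT : IsSemialgebraicFunOn ℚ T G := isSemialgebraicFunOn_weight hh hT subset_rfl
  have hGT' := hGT.mono hT'T hT's
  have hWT : IsSemialgebraicFunOn ℚ T W := isSemialgebraicFunOn_Wreal hρs hT subset_rfl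
  have hρ2s : IsSemialgebraicFunOn ℚ B (fun x => ρ x ^ 2) :=
    (IsSemialgebraicFunOn.mul_holds hρs hρs).congr fun x _ => by simp [sq]
  have hW₂T : IsSemialgebraicFunOn ℚ T W₂ := isSemialgebraicFunOn_Wreal hρ2s hT subset_rfl
  have hWT' := hWT.mono hT'T hT's
  have hW₂T' := hW₂T.mono hT'T hT's
  have hMs : IsSemialgebraicFunOn ℚ T' M := by
    have h1 := IsSemialgebraicFunOn.add_holds (isSemialgebraicFunOn_ratCast hT's 1) (hρs.comp_init.mono hT'B hT's)
    exact (IsSemialgebraicFunOn.mul_holds h1 h1).congr fun b _ => by simp [hM_def, sq]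
  have hMWs : IsSemialgebraicFunOn ℚ T' (fun b => M b * W b) := IsSemialgebraicFunOn.mul_holds hMs hWT'
  have hW0 : ∀ b ∈ T, 0 ≤ W b := fun b _ => by simp only [hW_def]; positivity
  have hW₂0 : ∀ b ∈ T, 0 ≤ W₂ b := fun b _ => by simp only [hW₂_def]; positivity
  have hWpos : ∀ b ∈ T', 0 < W b := fun b hb => by
    have h1 : (1 + ρ (Fin.init b)) ≠ 0 := by have := hρ0 _ hb.1; positivity
    exact (hW0 b hb.1).lt_of_ne (Ne.symm (W_ne_zero_of_ne h1 hb.2))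
  have hW₂pos : ∀ b ∈ T', 0 < W₂ b := fun b hb => by
    have h1 : (1 + ρ (Fin.init b) ^ 2) ≠ 0 := by positivity
    exact (hW₂0 b hb.1).lt_of_ne (Ne.symm (W_ne_zero_of_ne h1 hb.2))
  have hMpos : ∀ b ∈ T', 0 < M b := fun b hb => by have := hρ0 _ hb.1; simp only [hM_def]; positivity
  have hM14 : ∀ b ∈ T', 1 ≤ M b ∧ M b ≤ 4 := fun b hb => by
    have h0 := hρ0 _ hb.1; have h1 := hρ1 _ hb.1; simp only [hM_def]; constructor <;> nlinarith
  -- the band endpoints are ordered: `W₂ < M W` on `T'` (monotone path)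
  have hab : ∀ b ∈ T', W₂ b ≤ M b * W b := fun b hb => by
    have h0 := hρ0 _ hb.1; have h1 := hρ1 _ hb.1
    have hρρ : ρ (Fin.init b) ^ 2 < ρ (Fin.init b) := by nlinarith
    have hm := radF_strictMonoOn (s := b (Fin.last n)) h0 h1 hb.2 ⟨le_rfl, hρρ.le⟩ ⟨hρρ.le, le_rfl⟩ hρρ
    simp only at hm
    rw [radF_left (by nlinarith), radF_right h1.ne] at hm
    exact hm.le
  -- null set `{s = 0}`
  have hnull0 : volume {b : Fin (n + 1) → ℝ | b (Fin.last n) = 0} = 0 := volume_setOf_last_eq_zero 0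
  have hTT' : volume (T \ T') = 0 := measure_mono_null (fun b hb => by
    by_contra hs; exact hb.2 ⟨hb.1, hs⟩) hnull0
  ----------------------------------------------------------------
  -- r1: restrict both representations to `T'`
  ----------------------------------------------------------------
  have restr : ∀ (X : IntegralRep (n + 1 + 1)) (V : (Fin (n + 1) → ℝ) → ℝ), X.domain = logUnfoldDomain T V →
      EqOn X.integrand (logUnfoldIntegrand G) X.domain →
      ∃ X' : IntegralRep (n + 1 + 1), X'.domain = logUnfoldDomain T' V ∧
        EqOn X'.integrand (logUnfoldIntegrand G) X'.domain ∧ of X - of X' ∈ S := by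
    intro X V hXd hXi
    have s := of_sub_restrict_base_mem hS X hT's
    set X₁ := X.restrict (X.domain ∩ {z | Fin.init z ∈ T'})
      (X.isSemialgebraic_domain.inter (isSemialgebraic_cyl hT's)) inter_subset_left
    set X₂ := X.restrict (X.domain \ {z | Fin.init z ∈ T'})
      (X.isSemialgebraic_domain.diff (isSemialgebraic_cyl hT's)) sdiff_subset
    have e2 : of X₂ ∈ S := by
      refine of_mem_of_base_null hS X₂ hTT' fun z hz => ?_
      have hz' : z ∈ X.domain \ {z | Fin.init z ∈ T'} := hz
      rw [hXd] at hz'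
      exact ⟨hz'.1.1, hz'.2⟩
    refine ⟨X₁, by rw [IntegralRep.domain_restrict, hXd, logUnfoldDomain_inter_cyl, inter_eq_right.2 hT'T],
      fun z hz => hXi hz.1, ?_⟩
    have : of X - of X₁ = (of X - of X₁ - of X₂) + of X₂ := by abel
    rw [this]; exact S.add_mem s e2
  obtain ⟨R', hR'd, hR'i, e1⟩ := restr R W hRd hRi
  obtain ⟨R₂', hR₂'d, hR₂'i, e1'⟩ := restr R₂ W₂ hR₂d hR₂i
  ----------------------------------------------------------------
  -- r2: the auxiliary unfoldings `L(M)`, `L(M W)`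
  ----------------------------------------------------------------
  have hGi : IntegrableOn G T' := by
    have := integrableOn_cyl_mul (B := B) (f := h) (g := fun s : ℝ => (1 + s ^ 2)⁻¹) hhi integrable_inv_one_add_sq
    refine (this.mono_set hT'B).congr_fun (fun b _ => ?_) (IsSemialgebraic.measurableSet_holds hT's)
    simp only [hG_def, div_eq_mul_inv]
  have hGlogW : IntegrableOn (fun b => G b * Real.log (W b)) T' :=
    integrableOn_mul_log_of_logUnfold hT's hGT' hWT' hWpos
      (by rw [← hR'd]; exact R'.integrableOn.congr_fun hR'i (IntegralRep.measurableSet_domain_holds R'))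
  have hGlogW₂ : IntegrableOn (fun b => G b * Real.log (W₂ b)) T' :=
    integrableOn_mul_log_of_logUnfold hT's hGT' hW₂T' hW₂pos
      (by rw [← hR₂'d]; exact R₂'.integrableOn.congr_fun hR₂'i (IntegralRep.measurableSet_domain_holds R₂'))
  have hlog1 : IntegrableOn (fun b => G b * Real.log ((fun _ : Fin (n + 1) → ℝ => (1 : ℝ)) b)) T' := by
    simp only [Real.log_one, mul_zero]; exact integrableOn_zero
  have hc1 : IsSemialgebraicFunOn ℚ T' (fun _ => (1 : ℝ)) := by simpa using isSemialgebraicFunOn_ratCast hT's 1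
  have hGlogM : IntegrableOn (fun b => G b * Real.log (M b)) T' := by
    refine integrableOn_mul_log_of_bound (V₁ := fun _ => 1) (V₂ := fun _ => 1) hT's hGT' hMs (fun b hb => ?_) hGi hlog1 hlog1
    obtain ⟨h1, h4⟩ := hM14 b hb
    rw [Real.log_one, abs_zero, add_zero, add_zero, abs_of_nonneg (Real.log_nonneg h1)]
    calc Real.log (M b) ≤ Real.log 4 := Real.log_le_log (by linarith) h4
      _ = 2 * Real.log 2 := by rw [show (4 : ℝ) = 2 ^ 2 by norm_num, Real.log_pow]; norm_num
  have hGlogMW : IntegrableOn (fun b => G b * Real.log (M b * W b)) T' := by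
    refine (hGlogM.add hGlogW).congr_fun (fun b hb => ?_) (IsSemialgebraic.measurableSet_holds hT's)
    rw [Pi.add_apply, Real.log_mul (hMpos b hb).ne' (hWpos b hb).ne']; ring
  have hZ : ∀ {V : (Fin (n + 1) → ℝ) → ℝ}, (∀ b ∈ T', 0 < V b) → volume {b | b ∈ T' ∧ V b = 0} = 0 := fun hV => by
    rw [show {b | b ∈ T' ∧ _} = (∅ : Set (Fin (n + 1) → ℝ)) by
      ext b; simp only [mem_setOf_eq, mem_empty_iff_false, iff_false, not_and]
      exact fun hb h0 => (hV b hb).ne' h0]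
    exact measure_empty
  set LM : IntegralRep (n + 1 + 1) := logUnfoldRep T' M G hT's hGT' hMs (fun b hb => (hMpos b hb).le)
    (hZ hMpos) hGlogM with hLM
  set LMW : IntegralRep (n + 1 + 1) := logUnfoldRep T' (fun b => M b * W b) G hT's hGT' hMWs
    (fun b hb => (mul_pos (hMpos b hb) (hWpos b hb)).le) (hZ fun b hb => mul_pos (hMpos b hb) (hWpos b hb)) hGlogMW
    with hLMW
  ----------------------------------------------------------------
  -- r3: signed product rule; r4: the band; r5: Chasles; core
  ----------------------------------------------------------------
  have esp : of LMW - of LM - of R' ∈ S :=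
    of_logUnfold_prod_sub_sub_mem hS hT's hGT' hMs hWT' hMpos hWpos
      (fun b hb => by
        have hl : DifferentiableAt ℝ (fun b' : Fin (n + 1) → ℝ => ρ (Fin.init b')) b :=
          (hρd _ hb.1).comp b (ContinuousLinearMap.pi fun j => ContinuousLinearMap.proj (R := ℝ)
            (φ := fun _ : Fin (n + 1) => ℝ) (Fin.castSucc j)).differentiableAt
        exact ((differentiableAt_const _).add hl).pow 2)
      (fun b hb => by
        have := differentiableAt_Wgen (n := n) (b := b) (hρd _ hb.1) 1 (-1) 1 1
        refine this.congr_of_eventuallyEq (Filter.Eventually.of_forall fun b => ?_)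
        simp only [hW_def]; ring_nf)
      hGi hGlogM hGlogW LMW LM R' rfl (fun _ _ => rfl) rfl (fun _ _ => rfl) hR'd hR'i
  obtain ⟨Rband, hBd, hBi⟩ := exists_bandRep hT's hGT' hW₂T' hMWs hW₂pos hab hGlogW₂ hGlogMW
  have ech : of LMW - of R₂' - of Rband ∈ S :=
    of_logUnfold_sub_sub_band_mem hS hT's hW₂T' hMWs hab LMW R₂' Rband rfl (fun _ _ => rfl) hR₂'d hR₂'i hBd
      (by rw [hBi]; exact fun _ _ => rfl)
  have ecore : of Rband - of LM ∈ S :=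
    radial_core hS hB hh hρs hρ0 hρ1 hρd hhlog Rband LM hBd hBi rfl rfl
  have : of R - of R₂ = (of R - of R') - (of R₂ - of R₂') - (of LMW - of LM - of R') + (of LMW - of R₂' - of Rband) +
      (of Rband - of LM) := by abel
  rw [this]
  exact S.add_mem (S.add_mem (S.sub_mem (S.sub_mem e1 e1') esp) ech) ecore

end Summit.KontsevichZagierPeriods.K2SymbolChains.JensenIsScissorsProof
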